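import Summits.BirchSwinnertonDyer.BirchSwinnertonDyer.Theorems.KimAtThreeDeepLowerPortPairOfZetaBodyPow
import Summits.BirchSwinnertonDyer.BirchSwinnertonDyer.Theorems.KimAtThreeDeepLowerPortDeepTorsionUpper
import Summits.BirchSwinnertonDyer.BirchSwinnertonDyer.Theorems.KimAtThreeDeepUpperUniformOfFineKato
import HarnessLib

/-!
# Route `KimAtThreeKolyvagin` (rung W2): cruxes `DeepLowerAtThree` (19075), `DeepUpperAtThree` (19076), their
# off-stratum children 19679 / 19562 and the cell's DEEP statement `N11.KimAtThreeDeepPUB` BY NAME from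
# {[S24] Thm 4.4 (1)(2) PINNED, GZK, Poitou–Tate, Carayol} and ONE UNIFORM fine Kato package (C1ᵤ) — EVERY tower
# row, EVERY reduction type at `3`, EVERY `#E(ℚ₃)[3]`, NO port text, NO S24-DEEP flag

Cell `bsd-addord`, seat `bsd-addord-w2-c2` gen 7 (D-0074 row B5); `--supports` stmt-BirchSwinnertonDyer-19075.
HONEST FRAMING: glue/END-type theorems with DISPLAYED hypotheses (no definition, no named fact, no instance, no
`sorry`); the conclusions are route decls BY NAME but CONDITIONAL on the displayed package (C1ᵤ) and the four
cite-only leaves, so NOTHING is closed and nothing is booked; BSD is not proved by any of this.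

## What, and why

Seat w2-c3 gen 6's `KimAtThreeDeepUpperUniformOfFineKato` (p487287; the planner's W2 residual DISPLAY OF RECORD)
derives 19076 from S24-DEEP ×2 (FLAG), GZK, PT, Carayol and ONE package in ONE coordinate serving EVERY row:
(C1ᵤ) = for a tower-surjective `W`, a place `v₃ ∣ 3` and a lattice-optimal datum `P` at the conductor, Kato
witnesses `(ι, κK, Λ)` of the `ZetaBody` family with `κK` rational of `3`-valuation `κe ≥ 1`, functionals `Λfin j`
with the (Λ)-clauses and the two-exponent riders (ii₂) at some `(t, e)`.  This seat's gen 6 gave the LOWER / UPPER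
rows at every `t` from the PINNED [S24] facts + ONE deep-guard two-depth port (`deepLower_row_of_portDeep_tors`,
`deepUpper_row_of_portDeep_tors`), the port displayed.  **This file discharges that port from (C1ᵤ)** (prequel
`KimAtThreeDeepLowerPortPairOfZetaBodyPow` = acc3's ★★-stable pair on w2-c3's POW value rows) and concludes:
* `portPairDeep_of_fineKatoUniform` — per row, from (C1ᵤ) + the certificate-supply shape (C2ᵤ): the deep-guard
  two-depth port at `(t + α, e, M)` for SOME torsion-stable `M`, `α = κe + β − 1` (w2-c3's bookkeeping verbatim).
* `deepLower_optimalRow_of_lit_of_fineKatoUniform` / `deepUpper_optimalRow_of_lit_of_fineKatoUniform` — the two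
  rows at EVERY tower row with `Ш` finite and a lattice-optimal datum at the conductor, from [S24] (1)(2) PINNED,
  GZK, PT, (C1ᵤ) — (C2ᵤ) DISCHARGED by w2-c3's THEOREM `certSupply_uniform`.
* ★ `deepLowerAtThree_of_lit_of_fineKatoUniform` — **crux 19075 `DeepLowerAtThree` BY NAME ⟸ [S24] (1)(2) PINNED,
  GZK, PT, Carayol, (C1ᵤ) ALONE**; ★ `deepLowerAtThreeOffKatoStratum_of_lit_of_fineKatoUniform` (19679).
* ★ `deepUpperAtThree_of_lit_of_fineKatoUniform` — crux 19076 BY NAME from the same (w2-c3's ★ with the S24-DEEP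
  flag REMOVED); ★ `deepUpperAtThreeOffKatoStratum_of_lit_of_fineKatoUniform` (19562).
* ★★ `kimAtThreeDeepPUB_of_lit_of_fineKatoUniform` — **the cell's DEEP statement `N11.KimAtThreeDeepPUB` (Kim's
  `p = 3` Sha-length formula in the deep-limit currency on EVERY `3`-adic-tower row of analytic rank `0`) BY NAME
  ⟸ {[S24] Thm 4.4 (1)(2) PINNED, GZK, PT, Carayol} ∧ (C1ᵤ)**; and the route-leaf spelling `…_of_leaves_…`
  (`SakamotoKolyvaginThree` 19558, `RankEqAnalyticRankLeOne` 19921, `PoitouTateSelmerDuality` 19559,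
  `CarayolLevelEqConductor` 19467).
NET: the W2 residual on 19075 / 19679 / 19076 / 19562 / the deep statement is ONE object, (C1ᵤ), at every row.
HONEST LIMITS: (C1ᵤ) is construction-shaped (axioms on bound witnesses; model = Kato Thm 9.7 ∘ 6.6 (1) + [BK90]
Prop. 3.8 / Ex. 3.11 + Kim AJM Lemma 3.4 — the cell's `defn-BlochKatoDualExponential` / `defn-EllipticNeronDeRhamClass`
lane); the four leaves are cite-only named facts; nothing is closed.  Credit: w2-c3 ((C1ᵤ), certificate supply,
POW value rows, D-u), acc3/acc6 (two-exponent pair chain), acc1 (deep UPPER engine), kim3 (transports, deep iff),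
team n1011 (originals); this seat composes.  References: [Kato2004Asterisque] (8.1.3), Prop. 8.12, §9.4, Thm. 9.7,
Thm. 6.6 (1), Ex. 13.3; [Kim2022StructureSelmer] Lemma 3.4, Thm. 1.9 (6), Thm. 3.13, §2.2.2; [Kim2025RefinedTNC] Thm
1.1; [MazurRubin2004] Thm. 3.2.4, Thm. 5.2.12, App. A Prop. A.2; [Sakamoto2024] Thm. 4.4; [Carayol1986]. -/

set_option autoImplicit false
-- the Theorems namespace of a single-conjunct summit repeats the summit name by design (D-0017)
set_option linter.dupNamespace false

noncomputable section

open scoped NumberField TensorProduct ContRepresentation Classical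
open CategoryTheory Field Function Finset IsDedekindDomain NumberField WeierstrassCurve
open Rat.HeightOneSpectrum
open Literature.NumberTheory.GaloisRepresentations Literature.NumberTheory.GaloisCohomology
open Literature.NumberTheory.GaloisRepresentations.DiscreteGaloisModule
open Literature.NumberTheory.EllipticCurves Literature.NumberTheory.EllipticCurves.ModularForms
open Literature.NumberTheory.EllipticCurves.Rank1Residual
open Literature.NumberTheory.EllipticCurves.Kato2004
open Literature.NumberTheory.EllipticCurves.Kato2004.EulerSystemValues
open Summit.BirchSwinnertonDyer.Rank1Residual.GaloisImage
open Summit.BirchSwinnertonDyer.Rank1Residual.Additive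
open Summit.BirchSwinnertonDyer.BirchSwinnertonDyer.Theses.KimAtThreeKolyvagin
open Summit.BirchSwinnertonDyer.BirchSwinnertonDyer.Theorems.KimAtThreeKolyvaginDefs
open Summit.BirchSwinnertonDyer.BirchSwinnertonDyer.Theorems.KimAtThreeKolyvaginInputs
open Summit.BirchSwinnertonDyer.BirchSwinnertonDyer.Theorems.KimAtThreeKolyvaginIsogenyCruxes
open Summit.BirchSwinnertonDyer.BirchSwinnertonDyer.Theorems.KimAtThreeShallowEqDeepSplitGlueNoStub
open Summit.BirchSwinnertonDyer.BirchSwinnertonDyer.Theorems.KimAtThreeDeepUpperUniformOfFineKato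
open Summit.BirchSwinnertonDyer.BirchSwinnertonDyer.Theorems.KimAtThreeDeepLowerPortPairOfZetaBodyPow
open Summit.BirchSwinnertonDyer.BirchSwinnertonDyer.Theorems.KimAtThreeDeepLowerPortDeepTorsion
open Summit.BirchSwinnertonDyer.BirchSwinnertonDyer.Theorems.KimAtThreeDeepLowerPortDeepTorsionUpper

namespace Summit.BirchSwinnertonDyer.BirchSwinnertonDyer.Theorems.KimAtThreeDeepLowerUniformOfFineKato

/-- Local notation: the TWO-EXPONENT rider clause (ii₂) at depth `j`, torsion exponent `t`, defect exponent
`e`, place `v`, for the pair `(Λ, Λf)` — seat acc6's spelling (as in w2-c3's `KimAtThreeDeepUpperUniformOfFineKato`). -/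
local notation3 (prettyPrint := false) "RIDER₂⟦" W' ", " j ", " t' ", " e' ", " v' ", " Λ' ", " Λf "⟧" =>
  ∀ (r : Finset (HeightOneSpectrum (𝓞 ℚ)))
    (Ψ : H1 (tateRep W' 3) (cycSubgroup 3 0 r) →+
      continuousCohomology 1
        (subgroupRep (WeierstrassCurve.torsionGaloisModule W' (((3 : ℕ) : ℤ) ^ j * ((3 : ℕ) : ℤ))).toTopRep
          (cycSubgroup 3 0 r))),
    (∀ (φ : contOneCocycles (subgroupRep (tateRep W' 3).toTopRep (cycSubgroup 3 0 r)))
        (ψ : contOneCocycles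
          (subgroupRep (WeierstrassCurve.torsionGaloisModule W' (((3 : ℕ) : ℤ) ^ j * ((3 : ℕ) : ℤ))).toTopRep
            (cycSubgroup 3 0 r))),
        (∀ g, ((ψ.1 g : geomTorsion W' (((3 : ℕ) : ℤ) ^ j * ((3 : ℕ) : ℤ))) : geomPoints W') =
          TateModule.proj 3 (j + 1) (φ.1 g)) →
        Ψ (oneCocycleClass _ φ) = oneCocycleClass _ ψ) →
    ∀ (y : H1 (tateRep W' 3) (cycSubgroup 3 0 r))
      (κ₀ : galoisCohomology (WeierstrassCurve.torsionGaloisModule W' (((3 : ℕ) : ℤ) ^ j * ((3 : ℕ) : ℤ))) 1)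
      (s : ℤ_[3]),
      resSubgroup (WeierstrassCurve.torsionGaloisModule W' (((3 : ℕ) : ℤ) ^ j * ((3 : ℕ) : ℤ))).toTopRep
          (cycSubgroup 3 0 r) 1 κ₀ = Ψ y →
      galoisCohomology.localization (WeierstrassCurve.torsionGaloisModule W' (((3 : ℕ) : ℤ) ^ j * ((3 : ℕ) : ℤ)))
          (Sum.inr v') 1 κ₀ ∈ propagatedSelmerStructure W' 3 j (Sum.inr v') →
      (∃ l ∈ cycIntLattice 3 (cycLevel 3 0 r),
          (((3 : ℕ) : ℤ_[3]) ^ t') • Λ' 0 r y - ((s : ℚ_[3]) ⊗ₜ[ℚ] (1 : CyclotomicField (cycLevel 3 0 r) ℚ)) =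
            (((3 : ℕ) : ℤ_[3]) ^ (j + 1)) • (l : ℚ_[3] ⊗[ℚ] CyclotomicField (cycLevel 3 0 r) ℚ)) →
      ((3 ^ e' : ℕ) : ZMod (3 ^ (j + 1))) *
        Λf (galoisCohomology.localization
          (WeierstrassCurve.torsionGaloisModule W' (((3 : ℕ) : ℤ) ^ j * ((3 : ℕ) : ℤ))) (Sum.inr v') 1 κ₀) =
        PadicInt.toZModPow (j + 1) s

/-- Local notation: **the DEEP-GUARD TWO-DEPTH PORT at `(t, e, M)`** for `(W, v₃, η, P)` — the `hPort` binder of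
this seat's gen-6 `deepLower_row_of_portDeep_tors` / `deepUpper_row_of_portDeep_tors` VERBATIM (prequel's spelling). -/
local notation3 (prettyPrint := false) "PORTPAIR⟦" W' ", " t' ", " e' ", " M' ", " v' ", " η' ", " P' "⟧" =>
  ∀ (k k' : ℕ) (Dk : KolyvaginDatum (WeierstrassCurve.torsionGaloisModule W' (((3 : ℕ) : ℤ) ^ k * ((3 : ℕ) : ℤ))))
    (Dk' : KolyvaginDatum (WeierstrassCurve.torsionGaloisModule W' (((3 : ℕ) : ℤ) ^ k' * ((3 : ℕ) : ℤ))))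
    (red : (WeierstrassCurve.torsionGaloisModule W' (((3 : ℕ) : ℤ) ^ k' * ((3 : ℕ) : ℤ))).toContRepresentation →ⁱL
      (WeierstrassCurve.torsionGaloisModule W' (((3 : ℕ) : ℤ) ^ k * ((3 : ℕ) : ℤ))).toContRepresentation),
    Dk.IsCanonicalTauDatumThreeAtWith W' (k + M') k η' → Dk'.IsCanonicalTauDatumThreeAtWith W' (k' + M') k' η' →
    k ≤ k' →
    (∀ x : geomTorsion W' (((3 : ℕ) : ℤ) ^ k' * ((3 : ℕ) : ℤ)),
      ((red x : geomTorsion W' (((3 : ℕ) : ℤ) ^ k * ((3 : ℕ) : ℤ))) : geomPoints W') =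
        (((3 : ℕ) : ℤ) ^ (k' - k)) • (x : geomPoints W')) →
    ∃ κ Λ κ' κu Λu κu',
      KatoKuriharaWitnessAtTwoExp W' k t' e' Dk v' P' κ Λ κ' ∧
      KatoKuriharaWitnessAtTwoExp W' k' t' e' Dk' v' P' κu Λu κu' ∧
      ∀ d, Dk'.IsLevel d → Dk.IsLevel d →
        galoisCohomology.map red 1 (κu d) = κ d ∧ galoisCohomology.map red 1 (κu' d) = κ' d

section Uniform
variable
  -- (C1ᵤ) the UNIFORM fine Kato package: coordinate `Λ = 3^{κe}·exp*_ω` (`v₃(κK) = κe ≥ 1`), rider clause (ii₂)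
  -- at the row's exponents `(t, e)` — EVERY tower row, EVERY reduction type at `3` (w2-c3 g6's text VERBATIM)
  (hC1 : ∀ (W : WeierstrassCurve ℚ) [W.IsElliptic] [W.IsGloballyMinimal]
    [ContinuousSMul ℤ_[3] (W.tateModule 3)] [Module.Free ℤ_[3] (W.tateModule 3)]
    [Module.Finite ℤ_[3] (W.tateModule 3)],
    (∀ m : ℕ, W.HasSurjectiveModNGaloisRep (3 ^ m : ℕ)) →
    ∀ (v₃ : HeightOneSpectrum (𝓞 ℚ)), ((3 : ℕ) : 𝓞 ℚ) ∈ v₃.asIdeal →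
    ∀ {N : ℕ} [NeZero N] (P : ModularParametrizationData W N), N = W.conductorNorm ℤ →
      (∀ z ∈ P.L.lattice, ∃ w ∈ periodLattice P.f, z = P.c * w) →
      ∃ (t e κe : ℕ) (ι : (n : ℕ) → (CyclotomicField n ℚ →+* ℂ)) (κK : ℝ)
        (Λ : ∀ (k' : ℕ) (r : Finset (HeightOneSpectrum (𝓞 ℚ))),
          H1 (tateRep W 3) (cycSubgroup 3 k' r) →ₗ[ℤ_[3]] ℚ_[3] ⊗[ℚ] CyclotomicField (cycLevel 3 k' r) ℚ)
        (Λfin : ∀ j : ℕ, galoisCohomology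
          ((W.torsionGaloisModule (((3 : ℕ) : ℤ) ^ j * ((3 : ℕ) : ℤ))).toLocal (Sum.inr v₃)) 1 →+
            ZMod (3 ^ (j + 1))),
        κK ≠ 0 ∧ (∃ u : ℚ, (u : ℝ) = κK ∧ padicValRat 3 u = κe ∧ 1 ≤ κe) ∧
        (∀ j : ℕ,
          (∀ c : ZMod (3 ^ (j + 1)), ∃ x ∈ propagatedSelmerStructure W 3 j (Sum.inr v₃), Λfin j x = c) ∧
          (∀ x ∈ propagatedSelmerStructure W 3 j (Sum.inr v₃),
            Λfin j x = 0 ↔ x ∈ W.kummerSelmerStructure (((3 : ℕ) : ℤ) ^ j * ((3 : ℕ) : ℤ)) (Sum.inr v₃))) ∧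
        (∀ j : ℕ, RIDER₂⟦W, j, t, e, v₃, Λ, Λfin j⟧) ∧
        ∀ (c d a : ℤ) (A : ℕ), 0 < A → Int.gcd c (6 * 3 * A) = 1 → Int.gcd d (6 * 3 * N) = 1 →
          ∃ (z : ∀ (k' : ℕ) (r : (cyclotomicLevelsRat 3 (badPlaces c d A N)).Ideals),
                H1 (tateRep W 3) ((cyclotomicLevelsRat 3 (badPlaces c d A N)).level k' r.1))
            (x : ∀ (k' : ℕ) (r : (cyclotomicLevelsRat 3 (badPlaces c d A N)).Ideals),
                CyclotomicField (cycLevel 3 k' r.1) ℚ),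
            ZetaBody W 3 P.f ι κK Λ c d a A z x)

include hC1
/-! ### §1 EVERY tower row: the deep-guard two-depth port from (C1ᵤ) + (C2ᵤ) -/
/-- **The deep-guard two-depth port on EVERY tower row, from (C1ᵤ) + (C2ᵤ)** — per row: (C2ᵤ) gives Kato's
auxiliary datum, its certificates and `β`, (C1ᵤ) gives `(t, e, κe, ι, κK, Λ, Λfin)` and `ZetaBody` for that datum;
`v₃(κK) = κe ≥ 1` makes `uκ·a₃/3`, `uκ·𝟙/3` integral and — with the depletion certificate `β − 1` — the combined
certificate `α = κe + β − 1` (w2-c3's arithmetic verbatim); then the prequel's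
`exists_shift_portPairDeep_of_zetaBody_of_valueRows_pow`: the port at `(t + α, e, M)` for SOME torsion-stable `M`.
Instance binders of the Tate module are discharged by the tree's `_holds` theorems; `E[3]` is irreducible under the
tower.  Closes nothing; (C1ᵤ)/(C2ᵤ) stay displayed.
[cite: Kato2004Asterisque, (8.1.3) (p. 180), §9.4 (p. 188), Thm. 9.7 (p. 189) and Ex. 13.3 (pp. 224–225)]
[cite: Kim2022StructureSelmer, Thm. 3.13, Lemma 3.4 and §2.2.2] [cite: MazurRubin2004, App. A Prop. A.2 and Thm. 3.2.4] -/
theorem portPairDeep_of_fineKatoUniform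
    (hC2 : ∀ (W : WeierstrassCurve ℚ) [W.IsElliptic] [W.IsGloballyMinimal],
      (∀ m : ℕ, W.HasSurjectiveModNGaloisRep (3 ^ m : ℕ)) →
      ∀ {N : ℕ} [NeZero N] (P : ModularParametrizationData W N), N = W.conductorNorm ℤ →
        (∀ z ∈ P.L.lattice, ∃ w ∈ periodLattice P.f, z = P.c * w) →
        ∃ (c d a : ℤ) (A : ℕ) (d' : ℤ) (aM : ℕ → ℤ) (α : ℕ),
          0 < A ∧ Int.gcd c (6 * 3 * A) = 1 ∧ Int.gcd d (6 * 3 * N) = 1 ∧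
          (∀ q : ℕ, q.Prime → q ≡ 1 [MOD 3] → ¬ q ∣ 2 * c.natAbs * d.natAbs * A) ∧
          Int.gcd (c * d) A = 1 ∧ d * d' ≡ 1 [ZMOD (A : ℤ)] ∧ Nat.Coprime A N ∧
          (∀ q ∈ (3 * A).primeFactors, cuspCoeff P.f q = aM q) ∧
          (∏ q ∈ (3 * A).primeFactors,
              (1 - (aM q : ℚ) / q + (if q ∣ N then 0 else (1 / q : ℚ))) ≠ 0) ∧
          padicValRat 3 (∏ q ∈ (3 * A).primeFactors,
              (1 - (aM q : ℚ) / q + (if q ∣ N then 0 else (1 / q : ℚ)))) = (α : ℤ) - 1 ∧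
          ((c : ℚ) ^ 2 * (d : ℚ) ^ 2 * ratMinusSymbol P.f ((a : ℚ) / A) -
              (c : ℚ) * (d : ℚ) ^ 2 * ratMinusSymbol P.f ((a * c : ℚ) / A) -
              (c : ℚ) ^ 2 * (d : ℚ) * ratMinusSymbol P.f ((a * d' : ℚ) / A) +
              (c : ℚ) * (d : ℚ) * ratMinusSymbol P.f ((a * c * d' : ℚ) / A) ≠ 0) ∧
          padicValRat 3 ((c : ℚ) ^ 2 * (d : ℚ) ^ 2 * ratMinusSymbol P.f ((a : ℚ) / A) -
              (c : ℚ) * (d : ℚ) ^ 2 * ratMinusSymbol P.f ((a * c : ℚ) / A) -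
              (c : ℚ) ^ 2 * (d : ℚ) * ratMinusSymbol P.f ((a * d' : ℚ) / A) +
              (c : ℚ) * (d : ℚ) * ratMinusSymbol P.f ((a * c * d' : ℚ) / A)) = 0) :
    ∀ (W : WeierstrassCurve ℚ) [W.IsElliptic] [W.IsGloballyMinimal],
      (∀ m : ℕ, W.HasSurjectiveModNGaloisRep (3 ^ m : ℕ)) →
      ∀ (v₃ : HeightOneSpectrum (𝓞 ℚ)), ((3 : ℕ) : 𝓞 ℚ) ∈ v₃.asIdeal →
      ∀ (η : (q : HeightOneSpectrum (𝓞 ℚ)) → (ZMod (Ideal.absNorm q.asIdeal))ˣ)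
        {N : ℕ} [NeZero N] (P : ModularParametrizationData W N), N = W.conductorNorm ℤ →
        (∀ z ∈ P.L.lattice, ∃ w ∈ periodLattice P.f, z = P.c * w) →
        ∃ M t e : ℕ, PORTPAIR⟦W, t, e, M, v₃, η, P⟧ := by
  intro W _ _ htow v₃ hv₃ η N _ P hN hlat
  haveI : Fact (Nat.Prime 3) := ⟨Nat.prime_three⟩
  haveI : ContinuousSMul ℤ_[3] (W.tateModule 3) := TateModule.continuousSMul_padicInt
  haveI : Module.Free ℤ_[3] (W.tateModule 3) := W.module_free_tateModule_holds 3
  haveI : Module.Finite ℤ_[3] (W.tateModule 3) := W.module_finite_tateModule_holds 3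
  obtain ⟨c, d, a, A, d', aM, β, hApos, hcA, hdN, hcdA, hcd, hdd', hAN, haM, hE0, hE, hR0, hR⟩ :=
    hC2 W htow P hN hlat
  haveI : NeZero A := ⟨hApos.ne'⟩
  obtain ⟨t, e, κe, ι, κK, Λ, Λfin, hκ0, ⟨uκ, huκ, hvu, hκe⟩, hΛ, hfin₂, hz⟩ := hC1 W htow v₃ hv₃ P hN hlat
  obtain ⟨z, x, hbody⟩ := hz c d a A hApos hcA hdN
  have hirr : W.HasIrreducibleModPGaloisRep 3 :=
    KimAtThreeKolyvaginPortShared.hasIrreducibleModPGaloisRep_three_of_tower W htow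
  -- `v₃(uκ) = κe ≥ 1`: `uκ`, `uκ·a₃/3`, `uκ·𝟙/3` are `3`-integral; the combined certificate is `κe + β − 1`
  have huκ0 : uκ ≠ 0 := by rintro rfl; exact hκ0 (by rw [← huκ, Rat.cast_zero])
  have hnorm3 : ‖(uκ : ℚ_[3])‖ = (3 : ℝ) ^ (-(κe : ℤ)) := by
    rw [Padic.norm_eq_zpow_neg_valuation (by exact_mod_cast huκ0), Padic.valuation_ratCast, hvu]
    norm_num
  have hnorm3le : ‖(uκ : ℚ_[3])‖ ≤ 3⁻¹ := by
    rw [hnorm3, show (3 : ℝ)⁻¹ = (3 : ℝ) ^ (-(1 : ℤ)) by norm_num]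
    exact zpow_le_zpow_right₀ (by norm_num) (by omega)
  have huκ1 : ‖(uκ : ℚ_[3])‖ ≤ 1 := hnorm3le.trans (by norm_num)
  have hthird : ∀ m : ℤ, ‖((uκ * ((m : ℚ) / (3 : ℕ)) : ℚ) : ℚ_[3])‖ ≤ 1 := by
    intro m
    rw [Rat.cast_mul, norm_mul, Rat.cast_div, norm_div, Rat.cast_intCast, Rat.cast_natCast, Nat.cast_ofNat]
    have h3 : ‖(3 : ℚ_[3])‖ = 3⁻¹ := by
      have := Padic.norm_p (p := 3)
      simpa using this
    rw [h3]
    have hm : ‖((m : ℤ) : ℚ_[3])‖ ≤ 1 := Padic.norm_int_le_one m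
    have : ‖((m : ℤ) : ℚ_[3])‖ / 3⁻¹ = 3 * ‖((m : ℤ) : ℚ_[3])‖ := by field_simp
    rw [this]
    nlinarith [norm_nonneg ((m : ℤ) : ℚ_[3]), norm_nonneg (uκ : ℚ_[3])]
  have hκa : ‖((uκ * ((aM 3 : ℚ) / (3 : ℕ)) : ℚ) : ℚ_[3])‖ ≤ 1 := hthird (aM 3)
  have hκ1 : ‖((uκ * (if 3 ∣ N then 0 else (1 / (3 : ℕ) : ℚ)) : ℚ) : ℚ_[3])‖ ≤ 1 := by
    by_cases h3N : 3 ∣ N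
    · rw [if_pos h3N, mul_zero, Rat.cast_zero, norm_zero]; exact zero_le_one
    · rw [if_neg h3N]
      have h := hthird 1
      rw [Int.cast_one] at h
      exact h
  have hκE : padicValRat 3
      (uκ * ∏ q ∈ (3 * A).primeFactors, (1 - (aM q : ℚ) / q + (if q ∣ N then 0 else (1 / q : ℚ)))) =
        ((κe + β - 1 : ℕ) : ℤ) := by
    rw [padicValRat.mul huκ0 hE0, hvu, hE, Nat.cast_sub (hκe.trans (Nat.le_add_right κe β))]
    push_cast
    ring
  obtain ⟨M, hPort⟩ := exists_shift_portPairDeep_of_zetaBody_of_valueRows_pow W P hN hbody hirr hv₃ Λfin hΛ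
    hfin₂ (η := η) hcdA uκ huκ hκ0 huκ1 d' hcd hdd' hAN aM haM hκa hκ1 hE0 hκE hR0 hR
  exact ⟨M, t + (κe + β - 1), e, hPort⟩

/-! ### §2 The LOWER and UPPER rows at EVERY tower row from [S24] PINNED + GZK + PT + (C1ᵤ) -/
/-- **Crux 19075's conclusion at EVERY tower row with `Ш` finite and a lattice-optimal datum at the conductor
(`3`-integral plus symbols, `ord(δ̃) = 0`): `∃ d, ∂^{(∞)}_deep = d ∧ ∂⁽⁰⁾ ≤ ord₃ #Ш(3) + d`, from [S24] Thm 4.4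
(1)(2) PINNED, GZK, Poitou–Tate and (C1ᵤ) ALONE** — (C2ᵤ) is w2-c3's THEOREM `certSupply_uniform`, the port of
§1 feeds this seat's gen-6 reduction-blind LOWER row `deepLower_row_of_portDeep_tors` (a place over `3` and a
generator family from `exists_place_three_and_generators`).  NO reduction-type split, NO port text, NO S24-DEEP
flag, NO Manin / period / `c₃` / local-torsion hypothesis.
[cite: Kim2025RefinedTNC, Thm 1.1] [cite: Kim2022StructureSelmer, Thm. 1.9 (6), Thm. 3.13]
[cite: Sakamoto2024, Thm. 4.4 (1)(2) (p. 926)] [cite: MazurRubin2004, Thm. 5.2.12 and App. A Prop. A.2]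
[cite: MilneADT2006, Ch. I, Thm. 4.10] [cite: Kato2004Asterisque, (8.1.3), §9.4, Thm. 9.7 and Ex. 13.3] -/
theorem deepLower_optimalRow_of_lit_of_fineKatoUniform
    (hS24 : Sakamoto2024.kolyvaginSystems_freeRankOne_zmod_three_pow)
    (hS24₂ : Sakamoto2024.kolyvaginSystems_idealOfBasis_eq_fittingIdeal_zmod_three_pow)
    (hGZK : rank_eq_analyticRank_of_analyticRank_le_one)
    (hPT : poitouTate_selmerStructure_duality ℚ) :
    ∀ (W₀ : WeierstrassCurve ℚ) [W₀.IsElliptic] [W₀.IsGloballyMinimal],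
      (∀ n : ℕ, W₀.HasSurjectiveModNGaloisRep (3 ^ n : ℕ)) → Finite W₀.sha →
      ∀ {N : ℕ} [NeZero N], N = W₀.conductorNorm ℤ → ∀ (D₀ : ModularParametrizationData W₀ N),
        (∀ z ∈ D₀.L.lattice, ∃ w ∈ periodLattice D₀.f, z = D₀.c * w) →
        (∀ r : ℚ, ratPlusSymbol D₀.f r ≠ 0 → 0 ≤ padicValRat 3 (ratPlusSymbol D₀.f r)) →
        kuriharaVanishingOrder W₀ 3 D₀.f = 0 →
        ∃ d : ℕ, kuriharaPartialDeepInfty W₀ 3 D₀.f = d ∧ kuriharaPartial W₀ 3 D₀.f 0 ≤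
          ((padicValNat 3 (Nat.card (AddCommGroup.primaryComponent W₀.sha 3)) + d : ℕ) : ℕ∞) := by
  intro W₀ _ _ htow _ N _ hN D₀ hopt _ hord
  obtain ⟨v₃, η, hv₃, hη⟩ := exists_place_three_and_generators
  obtain ⟨M, t, e, hPort⟩ := portPairDeep_of_fineKatoUniform hC1
    (fun W _ _ htow' _ _ P hN' hlat' => certSupply_uniform W htow' P) W₀ htow v₃ hv₃ η D₀ hN hopt
  exact deepLower_row_of_portDeep_tors hS24 hS24₂ hGZK hPT W₀ htow hN D₀ t e M hord v₃ hv₃ η hη hPort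

/-- **Crux 19076's conclusion at EVERY tower row with `Ш` finite and a lattice-optimal datum at the conductor:
`∃ d, ∂^{(∞)}_deep = d ∧ ord₃ #Ш(3) + d ≤ ∂⁽⁰⁾`, from [S24] Thm 4.4 (1)(2) PINNED, GZK, Poitou–Tate and (C1ᵤ)
ALONE** — the port of §1 feeds this seat's gen-6 UPPER row `deepUpper_row_of_portDeep_tors` (acc1's deep engine
re-keyed on the pinned facts).  = w2-c3 g6's `deepUpper_optimalRow_of_deepFacts_of_fineKatoUniform` with the
S24-DEEP flag REMOVED. [cite: Kim2025RefinedTNC, Thm 1.1, §5] [cite: Kim2022StructureSelmer, Thm. 1.9 (6), Thm. 3.13]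
[cite: Sakamoto2024, Thm. 4.4 (1)(2) (p. 926)] [cite: MazurRubin2004, Thm. 4.4.1 and App. A Prop. A.2]
[cite: MilneADT2006, Ch. I, Thm. 4.10] [cite: Kato2004Asterisque, (8.1.3), §9.4, Thm. 9.7 and Ex. 13.3] -/
theorem deepUpper_optimalRow_of_lit_of_fineKatoUniform
    (hS24 : Sakamoto2024.kolyvaginSystems_freeRankOne_zmod_three_pow)
    (hS24₂ : Sakamoto2024.kolyvaginSystems_idealOfBasis_eq_fittingIdeal_zmod_three_pow)
    (hGZK : rank_eq_analyticRank_of_analyticRank_le_one)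
    (hPT : poitouTate_selmerStructure_duality ℚ) :
    ∀ (W₀ : WeierstrassCurve ℚ) [W₀.IsElliptic] [W₀.IsGloballyMinimal],
      (∀ n : ℕ, W₀.HasSurjectiveModNGaloisRep (3 ^ n : ℕ)) → Finite W₀.sha →
      ∀ {N : ℕ} [NeZero N], N = W₀.conductorNorm ℤ → ∀ (D₀ : ModularParametrizationData W₀ N),
        (∀ z ∈ D₀.L.lattice, ∃ w ∈ periodLattice D₀.f, z = D₀.c * w) →
        (∀ r : ℚ, ratPlusSymbol D₀.f r ≠ 0 → 0 ≤ padicValRat 3 (ratPlusSymbol D₀.f r)) →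
        kuriharaVanishingOrder W₀ 3 D₀.f = 0 →
        ∃ d : ℕ, kuriharaPartialDeepInfty W₀ 3 D₀.f = d ∧
          ((padicValNat 3 (Nat.card (AddCommGroup.primaryComponent W₀.sha 3)) + d : ℕ) : ℕ∞) ≤
            kuriharaPartial W₀ 3 D₀.f 0 := by
  intro W₀ _ _ htow _ N _ hN D₀ hopt hint hord
  obtain ⟨v₃, η, hv₃, hη⟩ := exists_place_three_and_generators
  obtain ⟨M, t, e, hPort⟩ := portPairDeep_of_fineKatoUniform hC1
    (fun W _ _ htow' _ _ P hN' hlat' => certSupply_uniform W htow' P) W₀ htow v₃ hv₃ η D₀ hN hopt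
  exact deepUpper_row_of_portDeep_tors hS24 hS24₂ hGZK hPT W₀ htow D₀ t e M hint hord v₃ hv₃ η hη hPort

/-! ### §3 ★ The cruxes and the deep statement BY NAME from {[S24] PINNED, GZK, PT, Carayol} ∧ (C1ᵤ) -/
/-- ★ **Crux `DeepLowerAtThree` (stmt-BirchSwinnertonDyer-19075) BY NAME ⟸ [S24] Thm 4.4 (1)(2) PINNED ∧ GZK ∧
Poitou–Tate ∧ Carayol ∧ (C1ᵤ)** — every row, every reduction type at `3`, every `#E(ℚ₃)[3]`; kim3 g9's transport to
optimal data at the conductor (`deepLowerAtThree_of_forall_optimalDatum_atConductor`: Carayol + isogeny invariance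
+ Edixhoven's optimal datum) fed §2.  NO port text, NO S24-DEEP flag, NO Kato-stratum split, NO stub.  CONDITIONAL:
does not close the item. [cite: Kim2025RefinedTNC, Thm 1.1] [cite: Sakamoto2024, Thm. 4.4 (p. 926)]
[cite: MazurRubin2004, Thm. 5.2.12 and App. A Prop. A.2] [cite: Carayol1986] [cite: EdixhovenManin1991, Prop. 2]
[cite: Kato2004Asterisque, (8.1.3) (p. 180), §9.4 and Thm. 9.7 (pp. 188–189), Ex. 13.3 (pp. 224–225)] -/
theorem deepLowerAtThree_of_lit_of_fineKatoUniform
    (hlev : ∀ (N : ℕ) [NeZero N], IsNewformOf.level_eq_conductorNorm (N := N))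
    (hS24 : Sakamoto2024.kolyvaginSystems_freeRankOne_zmod_three_pow)
    (hS24₂ : Sakamoto2024.kolyvaginSystems_idealOfBasis_eq_fittingIdeal_zmod_three_pow)
    (hGZK : rank_eq_analyticRank_of_analyticRank_le_one) (hPT : poitouTate_selmerStructure_duality ℚ) :
    Summit.BirchSwinnertonDyer.BirchSwinnertonDyer.Theses.KimAtThreeKolyvagin.DeepLowerAtThree :=
  deepLowerAtThree_of_forall_optimalDatum_atConductor hlev
    fun W₀ _ _ htow hfin _ _ hN D₀ hopt _ hint hord =>
      deepLower_optimalRow_of_lit_of_fineKatoUniform hC1 hS24 hS24₂ hGZK hPT W₀ htow hfin hN D₀ hopt hint hord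

/-- ★ **Crux `DeepLowerAtThreeOffKatoStratum` (stmt-BirchSwinnertonDyer-19679) BY NAME ⟸ the same** (the
off-stratum antecedent and degree-minimality are not used: the parent holds on every row).
[cite: Kim2025RefinedTNC, Thm 1.1] [cite: Sakamoto2024, Thm. 4.4 (p. 926)] [cite: MazurRubin2004, App. A Prop. A.2] -/
theorem deepLowerAtThreeOffKatoStratum_of_lit_of_fineKatoUniform
    (hlev : ∀ (N : ℕ) [NeZero N], IsNewformOf.level_eq_conductorNorm (N := N))
    (hS24 : Sakamoto2024.kolyvaginSystems_freeRankOne_zmod_three_pow)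
    (hS24₂ : Sakamoto2024.kolyvaginSystems_idealOfBasis_eq_fittingIdeal_zmod_three_pow)
    (hGZK : rank_eq_analyticRank_of_analyticRank_le_one) (hPT : poitouTate_selmerStructure_duality ℚ) :
    Summit.BirchSwinnertonDyer.BirchSwinnertonDyer.Theses.KimAtThreeKolyvagin.DeepLowerAtThreeOffKatoStratum := by
  intro W₀ _ _ htow hfin N _ _ D₀ _ _ hint hord _
  exact deepLowerAtThree_of_lit_of_fineKatoUniform hC1 hlev hS24 hS24₂ hGZK hPT W₀ htow hfin D₀.f
    D₀.isNewformOf hint hord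

/-- ★ **Crux `DeepUpperAtThree` (stmt-BirchSwinnertonDyer-19076) BY NAME ⟸ [S24] Thm 4.4 (1)(2) PINNED ∧ GZK ∧
Poitou–Tate ∧ Carayol ∧ (C1ᵤ)** — w2-c3 g6's ★ `deepUpperAtThree_of_deepFacts_of_fineKatoUniform` with the
S24-DEEP flag REMOVED (pinned facts via this seat's gen-6 deep family); kim3's transport fed §2.  CONDITIONAL.
[cite: Kim2025RefinedTNC, Thm 1.1] [cite: Sakamoto2024, Thm. 4.4 (p. 926)] [cite: Carayol1986]
[cite: MazurRubin2004, Thm. 4.4.1 and App. A Prop. A.2] [cite: Kato2004Asterisque, (8.1.3), §9.4, Thm. 9.7 and Ex. 13.3] -/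
theorem deepUpperAtThree_of_lit_of_fineKatoUniform
    (hlev : ∀ (N : ℕ) [NeZero N], IsNewformOf.level_eq_conductorNorm (N := N))
    (hS24 : Sakamoto2024.kolyvaginSystems_freeRankOne_zmod_three_pow)
    (hS24₂ : Sakamoto2024.kolyvaginSystems_idealOfBasis_eq_fittingIdeal_zmod_three_pow)
    (hGZK : rank_eq_analyticRank_of_analyticRank_le_one) (hPT : poitouTate_selmerStructure_duality ℚ) :
    Summit.BirchSwinnertonDyer.BirchSwinnertonDyer.Theses.KimAtThreeKolyvagin.DeepUpperAtThree :=
  deepUpperAtThree_of_forall_optimalDatum_atConductor hlev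
    fun W₀ _ _ htow hfin _ _ hN D₀ hopt _ hint hord =>
      deepUpper_optimalRow_of_lit_of_fineKatoUniform hC1 hS24 hS24₂ hGZK hPT W₀ htow hfin hN D₀ hopt hint hord

/-- ★ **Crux `DeepUpperAtThreeOffKatoStratum` (stmt-BirchSwinnertonDyer-19562) BY NAME ⟸ the same** (drop the
off-stratum antecedent). [cite: Kim2025RefinedTNC, Thm 1.1] [cite: Sakamoto2024, Thm. 4.4 (p. 926)]
[cite: MazurRubin2004, App. A Prop. A.2] -/
theorem deepUpperAtThreeOffKatoStratum_of_lit_of_fineKatoUniform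
    (hlev : ∀ (N : ℕ) [NeZero N], IsNewformOf.level_eq_conductorNorm (N := N))
    (hS24 : Sakamoto2024.kolyvaginSystems_freeRankOne_zmod_three_pow)
    (hS24₂ : Sakamoto2024.kolyvaginSystems_idealOfBasis_eq_fittingIdeal_zmod_three_pow)
    (hGZK : rank_eq_analyticRank_of_analyticRank_le_one) (hPT : poitouTate_selmerStructure_duality ℚ) :
    Summit.BirchSwinnertonDyer.BirchSwinnertonDyer.Theses.KimAtThreeKolyvagin.DeepUpperAtThreeOffKatoStratum := by
  intro W₀ _ _ htow hfin N _ _ D₀ _ _ hint hord _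
  exact deepUpperAtThree_of_lit_of_fineKatoUniform hC1 hlev hS24 hS24₂ hGZK hPT W₀ htow hfin D₀.f
    D₀.isNewformOf hint hord

/-- ★★ **The cell's DEEP statement `N11.KimAtThreeDeepPUB` BY NAME ⟸ [S24] Thm 4.4 (1)(2) PINNED ∧ GZK ∧
Poitou–Tate ∧ Carayol ∧ (C1ᵤ)** — Kim's `p = 3` Sha-length formula in the deep-limit currency, `∂^{(∞)}_deep(δ̃) = d
∈ ℕ` and `∂⁽⁰⁾(δ̃) = ord₃ #Ш(E)(3) + d`, on EVERY `3`-adic-tower row of analytic rank `0` (no `E(ℚ₃)[3]` /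
reduction-type binder): kim3's `kimAtThreeDeepPUB_iff_lower_and_upper` on the two ★ above.  The ONE residual object
of the whole W2 deep statement is (C1ᵤ) (construction-shaped; `defn-BlochKatoDualExponential` /
`defn-EllipticNeronDeRhamClass` lane).  CONDITIONAL: does not discharge the obligation node; nothing booked.
[cite: Kim2025RefinedTNC, Thm 1.1] [cite: Kim2022StructureSelmer, Thm. 1.9 (6), Thm. 3.13]
[cite: MazurRubin2004, App. A Prop. A.2, Thm. 4.4.1 and Thm. 5.2.12] [cite: Sakamoto2024, Thm. 4.4 (p. 926)] [cite: Carayol1986]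
[cite: Kato2004Asterisque, (8.1.3) (p. 180), §9.4 and Thm. 9.7 (pp. 188–189), Ex. 13.3 (pp. 224–225)] -/
theorem kimAtThreeDeepPUB_of_lit_of_fineKatoUniform
    (hlev : ∀ (N : ℕ) [NeZero N], IsNewformOf.level_eq_conductorNorm (N := N))
    (hS24 : Sakamoto2024.kolyvaginSystems_freeRankOne_zmod_three_pow)
    (hS24₂ : Sakamoto2024.kolyvaginSystems_idealOfBasis_eq_fittingIdeal_zmod_three_pow)
    (hGZK : rank_eq_analyticRank_of_analyticRank_le_one) (hPT : poitouTate_selmerStructure_duality ℚ) : N11.KimAtThreeDeepPUB :=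
  kimAtThreeDeepPUB_iff_lower_and_upper.mpr ⟨deepLowerAtThree_of_lit_of_fineKatoUniform hC1 hlev hS24 hS24₂ hGZK hPT,
    deepUpperAtThree_of_lit_of_fineKatoUniform hC1 hlev hS24 hS24₂ hGZK hPT⟩

/-- ★★ **Route-leaf spelling: `N11.KimAtThreeDeepPUB` ⟸ `SakamotoKolyvaginThree` (19558) ∧ `RankEqAnalyticRankLeOne`
(19921) ∧ `PoitouTateSelmerDuality` (19559) ∧ `CarayolLevelEqConductor` (19467) ∧ (C1ᵤ)** (Theses names).
[cite: Kim2025RefinedTNC, Thm 1.1] [cite: Sakamoto2024, Thm. 4.4 (p. 926)] [cite: Carayol1986] -/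
theorem kimAtThreeDeepPUB_of_leaves_of_fineKatoUniform (hlev : CarayolLevelEqConductor)
    (hSak : SakamotoKolyvaginThree) (hGZK : RankEqAnalyticRankLeOne) (hPT : PoitouTateSelmerDuality) :
    N11.KimAtThreeDeepPUB :=
  kimAtThreeDeepPUB_of_lit_of_fineKatoUniform hC1 hlev hSak.1 hSak.2 hGZK hPT

/-- ★ Route-leaf spelling, both parent cruxes: `DeepLowerAtThree ∧ DeepUpperAtThree` ⟸ the four leaves ∧ (C1ᵤ).
[cite: Kim2025RefinedTNC, Thm 1.1] [cite: Sakamoto2024, Thm. 4.4 (p. 926)] -/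
theorem deepLower_and_deepUpper_of_leaves_of_fineKatoUniform (hlev : CarayolLevelEqConductor)
    (hSak : SakamotoKolyvaginThree) (hGZK : RankEqAnalyticRankLeOne) (hPT : PoitouTateSelmerDuality) :
    DeepLowerAtThree ∧ DeepUpperAtThree :=
  ⟨deepLowerAtThree_of_lit_of_fineKatoUniform hC1 hlev hSak.1 hSak.2 hGZK hPT,
    deepUpperAtThree_of_lit_of_fineKatoUniform hC1 hlev hSak.1 hSak.2 hGZK hPT⟩

end Uniform

end Summit.BirchSwinnertonDyer.BirchSwinnertonDyer.Theorems.KimAtThreeDeepLowerUniformOfFineKato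

end
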